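import Summits.RiemannHypothesis.RiemannHypothesis.Theorems.SignConeCondRungLowFreq

/-!
# Route SignCone — Krein–Turán rung, II: the low-frequency lemma for a difference of tests

Support for the crux `SignConeInequality` (stmt-RiemannHypothesis-16301; plan `Cruxes/SignConeInequality/KREIN-TURAN-RUNG.md`,
Theorem A′). `SignConeCondRungLowFreq` bounds `Re W(u ⋆ ũ)` from below under numerical RH; Theorem A′ needs the same for
the DIFFERENCE `W(G) − W(V)` of two autocorrelations (`G = g ⋆ g̃`, `V = v ⋆ ṽ`, `v` the high-frequency part of `g`), whose
transform `Ĝ − V̂` is non-negative at the zeros on the critical line but is not itself a squared modulus. We therefore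
re-run the argument for an arbitrary function `Φ` on the zeros (`re_sum_zeros_ge_of_rhUpTo_of_nonneg`: on-line terms
`m(ρ) Re Φ(ρ) ≥ 0` by hypothesis, off-line terms above height `H` against the unconditional tail `tailInvImSq H`) and take
limits in the explicit formula for both tests (`re_weilFunctional_sub_ge_of_rhUpTo`).
-/

noncomputable section

-- `Summit.RiemannHypothesis.RiemannHypothesis.…` repeats a namespace component by design (D-0017 layout).
set_option linter.dupNamespace false

open scoped BigOperators ComplexConjugate Real Topology
open Complex MeasureTheory Set Filter

namespace Summit.RiemannHypothesis.RiemannHypothesis.Theorems.SignCone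

open Literature.NumberTheory.LFunctions
open Literature.NumberTheory.LFunctions.NicolasJExplicit (Zeros)
open Literature.NumberTheory.LFunctions.SchoenfeldBound (zerosUpTo mem_zerosUpTo)
open Literature.NumberTheory.LFunctions.ZetaZeroTails (tailInvImSq summable_tailInvImSq tailInvImSq_nonneg)

variable {H K : ℝ} {k : ℕ}

/-- Core estimate over a finite set of non-trivial zeros for an arbitrary `Φ`: if `Re Φ(ρ) ≥ 0` at the zeros on the
critical line, every zero with `|Im ρ| ≤ H` is on the line, and `‖Φ(ρ)‖ ≤ K/|Im ρ|^k` (`k ≥ 2`) above height `H`, then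
`−(K/H^{k−2}) · tailInvImSq H ≤ Re Σ_{ρ ∈ S} m(ρ) Φ(ρ)`. [folklore] -/
theorem re_sum_zeros_ge_of_rhUpTo_of_nonneg (hH : 1 ≤ H) (hRH : RiemannHypothesisInStripUpTo H)
    (hK0 : 0 ≤ K) (hk : 2 ≤ k) {Φ : ℂ → ℂ}
    (hpos : ∀ ρ : ℂ, riemannZeta ρ = 0 → ρ.re = 1 / 2 → 0 ≤ (Φ ρ).re)
    (hK : ∀ ρ : ℂ, riemannZeta ρ = 0 → 0 < ρ.re → ρ.re < 1 → H < |ρ.im| → ‖Φ ρ‖ ≤ K / |ρ.im| ^ k)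
    (S : Finset Zeros) :
    -(K / H ^ (k - 2) * tailInvImSq H) ≤ ∑ ρ ∈ S, ((riemannZetaZeroOrder (ρ : ℂ) : ℂ) * Φ ρ).re := by
  classical
  rw [← Finset.sum_filter_add_sum_filter_not S (fun ρ : Zeros => |(ρ : ℂ).im| ≤ H)]
  -- below height H: on the line, non-negative
  have h1 : 0 ≤ ∑ ρ ∈ S.filter (fun ρ : Zeros => |(ρ : ℂ).im| ≤ H),
      ((riemannZetaZeroOrder (ρ : ℂ) : ℂ) * Φ ρ).re := by
    refine Finset.sum_nonneg fun ρ hρ => ?_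
    rw [Finset.mem_filter] at hρ
    have hmem : (ρ : ℂ) ∈ ZetaZeros.riemannZetaNontrivialZeros := ρ.2
    have hz := ZetaZeros.riemannZetaNontrivialZeros.zeta_eq_zero hmem
    have hre : (ρ : ℂ).re = 1 / 2 :=
      hRH ρ hz (ZetaZeros.riemannZetaNontrivialZeros.re_pos hmem) (ZetaZeros.riemannZetaNontrivialZeros.re_lt_one hmem) hρ.2
    rw [← Complex.ofReal_intCast, Complex.re_ofReal_mul]
    have hm0 : (0 : ℝ) ≤ riemannZetaZeroOrder (ρ : ℂ) := by
      exact_mod_cast riemannZetaZeroOrder_nonneg (ZetaZeros.riemannZetaNontrivialZeros.ne_one hmem)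
    exact mul_nonneg hm0 (hpos ρ hz hre)
  -- above height H: the decay bound against the tail sum
  set f : Zeros → ℝ := fun ρ => if ρ ∈ zerosUpTo H then (0 : ℝ) else
    (riemannZetaZeroOrder (ρ : ℂ) : ℝ) / (ρ : ℂ).im ^ 2 with hf
  have hfnn : ∀ ρ, 0 ≤ f ρ := fun ρ => by
    simp only [hf]
    split_ifs
    · exact le_rfl
    · exact div_nonneg (NicolasJExplicit.zeroOrder_nonneg' ρ) (sq_nonneg _)
  have h2 : -(K / H ^ (k - 2) * tailInvImSq H) ≤ ∑ ρ ∈ S.filter (fun ρ : Zeros => ¬ |(ρ : ℂ).im| ≤ H),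
      ((riemannZetaZeroOrder (ρ : ℂ) : ℂ) * Φ ρ).re := by
    set S₂ : Finset Zeros := S.filter (fun ρ : Zeros => ¬ |(ρ : ℂ).im| ≤ H) with hS₂
    have hsum : ∑ ρ ∈ S₂, f ρ ≤ tailInvImSq H :=
      (summable_tailInvImSq hH).sum_le_tsum S₂ (fun ρ _ => hfnn ρ)
    have hterm : ∀ ρ ∈ S₂, -(K / H ^ (k - 2) * f ρ) ≤ ((riemannZetaZeroOrder (ρ : ℂ) : ℂ) * Φ ρ).re := by
      intro ρ hρ
      rw [hS₂, Finset.mem_filter, not_le] at hρ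
      have hmem : (ρ : ℂ) ∈ ZetaZeros.riemannZetaNontrivialZeros := ρ.2
      have hnot : ρ ∉ zerosUpTo H := fun h' => (not_le.2 hρ.2) (mem_zerosUpTo.1 h')
      simp only [hf]
      rw [if_neg hnot]
      have hb := hK ρ (ZetaZeros.riemannZetaNontrivialZeros.zeta_eq_zero hmem)
        (ZetaZeros.riemannZetaNontrivialZeros.re_pos hmem) (ZetaZeros.riemannZetaNontrivialZeros.re_lt_one hmem) hρ.2
      have := re_term_ge_of_decay (by linarith) hK0 hk (NicolasJExplicit.zeroOrder_nonneg' ρ) hρ.2 hb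
      rw [Complex.ofReal_intCast] at this
      exact this
    calc -(K / H ^ (k - 2) * tailInvImSq H) ≤ -(K / H ^ (k - 2) * ∑ ρ ∈ S₂, f ρ) := by
          have : 0 ≤ K / H ^ (k - 2) := by positivity
          nlinarith
      _ = ∑ ρ ∈ S₂, -(K / H ^ (k - 2) * f ρ) := by rw [Finset.mul_sum, Finset.sum_neg_distrib]
      _ ≤ _ := Finset.sum_le_sum hterm
  linarith

/-- **Low-frequency lemma for a difference of tests.** For Weil tests `F₁, F₂` with
`Re (F̂₁ − F̂₂)(ρ) ≥ 0` at the zeros on the critical line and `‖(F̂₁ − F̂₂)(ρ)‖ ≤ K/|Im ρ|^k` (`k ≥ 2`) at the zeros of the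
open strip above height `H`, numerical RH to height `H` gives
`Re W(F₁) − Re W(F₂) ≥ −(K/H^{k−2}) · Σ_{|Im ρ|>H} m(ρ)/(Im ρ)²` (explicit formula for both tests, limits of the truncated
zero sides). [folklore] -/
theorem re_weilFunctional_sub_ge_of_rhUpTo {F₁ F₂ : ℝ → ℂ} (h₁ : IsWeilTest F₁) (h₂ : IsWeilTest F₂)
    (hH : 1 ≤ H) (hRH : RiemannHypothesisInStripUpTo H) (hK0 : 0 ≤ K) (hk : 2 ≤ k)
    (hpos : ∀ ρ : ℂ, riemannZeta ρ = 0 → ρ.re = 1 / 2 → 0 ≤ (weilMellin F₁ ρ - weilMellin F₂ ρ).re)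
    (hK : ∀ ρ : ℂ, riemannZeta ρ = 0 → 0 < ρ.re → ρ.re < 1 → H < |ρ.im| →
      ‖weilMellin F₁ ρ - weilMellin F₂ ρ‖ ≤ K / |ρ.im| ^ k) :
    -(K / H ^ (k - 2) * tailInvImSq H) ≤ (weilFunctional F₁).re - (weilFunctional F₂).re := by
  have hlim₁ : Tendsto (fun T => (weilZeroSidePartial F₁ T).re) atTop (𝓝 (weilFunctional F₁).re) :=
    (Complex.continuous_re.tendsto _).comp (explicit_formula_holds h₁)
  have hlim₂ : Tendsto (fun T => (weilZeroSidePartial F₂ T).re) atTop (𝓝 (weilFunctional F₂).re) :=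
    (Complex.continuous_re.tendsto _).comp (explicit_formula_holds h₂)
  refine ge_of_tendsto' (hlim₁.sub hlim₂) fun T => ?_
  have e : (weilZeroSidePartial F₁ T).re - (weilZeroSidePartial F₂ T).re =
      ∑ ρ ∈ weilZeroFinset T, ((riemannZetaZeroOrder (ρ : ℂ) : ℂ) * (weilMellin F₁ ρ - weilMellin F₂ ρ)).re := by
    rw [weilZeroSidePartial_eq_sum, weilZeroSidePartial_eq_sum, ← Complex.sub_re, ← Finset.sum_sub_distrib,
      Complex.re_sum]
    refine Finset.sum_congr rfl fun ρ _ => ?_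
    rw [mul_sub]
  rw [e]
  exact re_sum_zeros_ge_of_rhUpTo_of_nonneg hH hRH hK0 hk hpos hK (weilZeroFinset T)

end Summit.RiemannHypothesis.RiemannHypothesis.Theorems.SignCone

end
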